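import Mathlib
import Literature.AlgebraicGeometry.Resolution.RegularLocalRingsQuotient
import Literature.Algebra.Derivations.DerivationOrder
import HarnessLib

/-!
# [OURS · L1 W4.5(b) · EL♮(3) · door ν4, brick N-0 (JINIT at `RD := RPlus`), piece (N0-c)] NODE-REGULARITY RING CORE
# («regular off the node sections» WITHOUT Serre's localisation theorem)

res-L1-w45b-nose-w1 g4 (WIDTH seat D-0157 DOOR 1).  Pure commutative algebra, `import Mathlib` + two Literature files; DEF-FREE; no `sorry`;
standard axioms.  `--supports stmt-ResolutionOfSingularities-20148 --as helper`, counted 0.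

WHAT.  The `NoseDatum` clause «`V(𝓦₀)` is regular at every point off the node sections» of brick N-0 is proved stalk-by-stalk from the
REGULAR ambient (`ℙ²_O`, given) by the criterion `R_𝔭 regular ∧ G ∉ 𝔭⁽²⁾ ⇒ R_𝔭/(G) regular` (Literature ✓ `IsRegularLocalRing.quotient_span_singleton`,
Matsumura 14.2), where membership in the symbolic square is REFUTED BY A DERIVATION: `G ∈ 𝔭`, `D G ∉ 𝔭 ⇒ G ∉ 𝔭⁽²⁾` (§1).  Two sources of such `D`:
(part 2, …NatEquinodalNodeRegularTaylor) at a REGULAR closed point of the reduced special fibre the gradient of the reduced equation does not vanish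
(Taylor: `f(α) = 0 ∧ ∇f(α) = 0 ⇒ f ∈ 𝔪_α²`); (§2 here) at a MARKED NODE — `G = a u² + b uv + c v² + h`, `h ∈ (u,v)³`, `b² − 4ac` a unit, `D₁, D₂` dual to `u, v` — NAKAYAMA gives
`(u, v) ≤ (D₁ G, D₂ G)` locally, so every prime `𝔭 ⊆ 𝔪_node` containing `D₁ G, D₂ G` contains the section ideal `(u, v)`: the singular locus of `V(G)`
near the node IS the section (generic fibre included), every characteristic (in char 2 the unit is `b²`).
Nothing here is specific to the crux; no scheme appears.  EL♮(3) is NOT proved; resolution in positive characteristic is NOT proved.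
-/

set_option linter.dupNamespace false -- mandated namespace `Summit.<Summit>.<Problem>` of this single-conjunct summit

noncomputable section

open IsLocalRing MvPolynomial

namespace Summit.ResolutionOfSingularities.ResolutionOfSingularities.Cruxes.EquisingularLiftNat.Sections.Equinodal.NodeReg

/-! ## §1 Derivations refute membership in the symbolic square -/

section Symbolic

variable {S R : Type*} [CommSemiring S] [CommRing R] [Algebra S R]

/-- A derivation maps `I^(n+1)` into `I^n` (any scalars; Literature ✓ `derivation_apply_mem_pow` is the `ℤ` case). [folklore] -/
theorem derivation_apply_mem_pow (D : Derivation S R R) (I : Ideal R) (n : ℕ) {f : R} (hf : f ∈ I ^ (n + 1)) :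
    D f ∈ I ^ n :=
  Literature.Algebra.Derivations.derivation_apply_mem_pow (D.restrictScalars ℤ) I n hf

/-- **`G ∈ 𝔭`, `s ∉ 𝔭`, `s·G ∈ 𝔭²` ⇒ `D G ∈ 𝔭`**: a derivation maps the symbolic square `𝔭⁽²⁾` into `𝔭`. [folklore] -/
theorem derivation_mem_of_mul_mem_sq (D : Derivation S R R) {𝔭 : Ideal R} [𝔭.IsPrime] {G s : R}
    (hG : G ∈ 𝔭) (hs : s ∉ 𝔭) (hsG : s * G ∈ 𝔭 ^ 2) : D G ∈ 𝔭 := by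
  have h1 : D (s * G) ∈ 𝔭 := by simpa using derivation_apply_mem_pow D 𝔭 1 hsG
  rw [Derivation.leibniz, smul_eq_mul, smul_eq_mul] at h1
  have h2 : s * D G ∈ 𝔭 := by
    have : G * D s ∈ 𝔭 := Ideal.mul_mem_right _ _ hG
    simpa using (Ideal.add_mem_iff_left 𝔭 this).mp h1
  exact ((Ideal.IsPrime.mem_or_mem ‹_› h2).resolve_left hs)

variable {Rₚ : Type*} [CommRing Rₚ] [IsLocalRing Rₚ] [Algebra R Rₚ] (𝔭 : Ideal R) [𝔭.IsPrime] [IsLocalization.AtPrime Rₚ 𝔭]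

/-- Membership of `G/1` in `𝔪_{R_𝔭}²` means `s·G ∈ 𝔭²` for some `s ∉ 𝔭`. [folklore] -/
theorem exists_mul_mem_sq_of_algebraMap_mem_sq {G : R} (hG : algebraMap R Rₚ G ∈ maximalIdeal Rₚ ^ 2) :
    ∃ s ∉ 𝔭, s * G ∈ 𝔭 ^ 2 := by
  rw [← IsLocalization.AtPrime.map_eq_maximalIdeal 𝔭 Rₚ, ← Ideal.map_pow,
    IsLocalization.mem_map_algebraMap_iff 𝔭.primeCompl] at hG
  obtain ⟨⟨⟨a, ha⟩, ⟨m, hm⟩⟩, h⟩ := hG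
  simp only at h
  rw [← map_mul] at h
  obtain ⟨⟨c, hc⟩, hc'⟩ := (IsLocalization.eq_iff_exists 𝔭.primeCompl Rₚ).mp h
  simp only at hc'
  refine ⟨c * m, fun hcm => ?_, ?_⟩
  · rcases Ideal.IsPrime.mem_or_mem ‹_› hcm with h' | h'
    · exact hc h'
    · exact hm h'
  · have : c * m * G = c * a := by rw [mul_assoc, mul_comm m G, hc']
    rw [this]
    exact Ideal.mul_mem_left _ _ ha

/-- **`G ∈ 𝔭`, `D G ∉ 𝔭` ⇒ `G/1 ∉ 𝔪_{R_𝔭}²`.** [folklore] -/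
theorem algebraMap_not_mem_sq_of_derivation_not_mem (D : Derivation S R R) {G : R} (hG : G ∈ 𝔭) (hDG : D G ∉ 𝔭) :
    algebraMap R Rₚ G ∉ maximalIdeal Rₚ ^ 2 := by
  intro h
  obtain ⟨s, hs, hsG⟩ := exists_mul_mem_sq_of_algebraMap_mem_sq 𝔭 h
  exact hDG (derivation_mem_of_mul_mem_sq D hG hs hsG)

omit [IsLocalRing Rₚ] in
/-- **THE REGULARITY CRITERION**: `R_𝔭` regular, `G ∈ 𝔭`, `D G ∉ 𝔭` for a derivation `D` ⇒ `R_𝔭 / (G)` is a regular local ring of dimension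
`dim R_𝔭 − 1` (Matsumura 14.2 via Literature ✓ `IsRegularLocalRing.quotient_span_singleton`). [folklore] -/
theorem isRegularLocalRing_quotient_of_derivation_not_mem [IsRegularLocalRing Rₚ] (D : Derivation S R R) {G : R} (hG : G ∈ 𝔭)
    (hDG : D G ∉ 𝔭) :
    IsRegularLocalRing (Rₚ ⧸ Ideal.span {algebraMap R Rₚ G}) ∧
      ringKrullDim (Rₚ ⧸ Ideal.span {algebraMap R Rₚ G}) + 1 = ringKrullDim Rₚ :=
  Literature.AlgebraicGeometry.Resolution.IsRegularLocalRing.quotient_span_singleton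
    ((IsLocalization.AtPrime.to_map_mem_maximal_iff Rₚ 𝔭 G).mpr hG)
    (algebraMap_not_mem_sq_of_derivation_not_mem 𝔭 D hG hDG)

end Symbolic

/-! ## §2 The node: `(u, v) ≤ (D₁ G, D₂ G)` locally (Nakayama), so the singular locus near the node is the section -/

section Node

variable {S R : Type*} [CommSemiring S] [CommRing R] [Algebra S R]

/-- The derivative of the node equation along `D₁` (dual to `u`): `D₁ G ≡ 2a·u + b·v (mod (u,v)²)`. [folklore; computation] -/
theorem node_deriv_fst_sub_mem_sq (D₁ : Derivation S R R) (u v a b c h : R) (hu : D₁ u = 1) (hv : D₁ v = 0)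
    (hh : h ∈ Ideal.span {u, v} ^ 3) :
    D₁ (a * u ^ 2 + b * u * v + c * v ^ 2 + h) - (2 * a * u + b * v) ∈ Ideal.span {u, v} ^ 2 := by
  have hu2 : u ^ 2 ∈ Ideal.span {u, v} ^ 2 := Ideal.pow_mem_pow (Ideal.subset_span (by simp)) 2
  have huv : u * v ∈ Ideal.span {u, v} ^ 2 := by
    rw [pow_two]; exact Ideal.mul_mem_mul (Ideal.subset_span (by simp)) (Ideal.subset_span (by simp))
  have hv2 : v ^ 2 ∈ Ideal.span {u, v} ^ 2 := Ideal.pow_mem_pow (Ideal.subset_span (by simp)) 2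
  have hDh : D₁ h ∈ Ideal.span {u, v} ^ 2 := derivation_apply_mem_pow D₁ _ 2 hh
  have key : D₁ (a * u ^ 2 + b * u * v + c * v ^ 2 + h) - (2 * a * u + b * v) =
      D₁ a * u ^ 2 + D₁ b * (u * v) + D₁ c * v ^ 2 + D₁ h := by
    simp only [map_add, Derivation.leibniz, Derivation.leibniz_pow, smul_eq_mul, hu, hv]
    ring
  rw [key]
  refine Ideal.add_mem _ (Ideal.add_mem _ (Ideal.add_mem _ ?_ ?_) ?_) hDh
  · exact Ideal.mul_mem_left _ _ hu2
  · exact Ideal.mul_mem_left _ _ huv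
  · exact Ideal.mul_mem_left _ _ hv2

/-- The derivative along `D₂` (dual to `v`): `D₂ G ≡ b·u + 2c·v (mod (u,v)²)`. [folklore; computation] -/
theorem node_deriv_snd_sub_mem_sq (D₂ : Derivation S R R) (u v a b c h : R) (hu : D₂ u = 0) (hv : D₂ v = 1)
    (hh : h ∈ Ideal.span {u, v} ^ 3) :
    D₂ (a * u ^ 2 + b * u * v + c * v ^ 2 + h) - (b * u + 2 * c * v) ∈ Ideal.span {u, v} ^ 2 := by
  have hu2 : u ^ 2 ∈ Ideal.span {u, v} ^ 2 := Ideal.pow_mem_pow (Ideal.subset_span (by simp)) 2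
  have huv : u * v ∈ Ideal.span {u, v} ^ 2 := by
    rw [pow_two]; exact Ideal.mul_mem_mul (Ideal.subset_span (by simp)) (Ideal.subset_span (by simp))
  have hv2 : v ^ 2 ∈ Ideal.span {u, v} ^ 2 := Ideal.pow_mem_pow (Ideal.subset_span (by simp)) 2
  have hDh : D₂ h ∈ Ideal.span {u, v} ^ 2 := derivation_apply_mem_pow D₂ _ 2 hh
  have key : D₂ (a * u ^ 2 + b * u * v + c * v ^ 2 + h) - (b * u + 2 * c * v) =
      D₂ a * u ^ 2 + D₂ b * (u * v) + D₂ c * v ^ 2 + D₂ h := by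
    simp only [map_add, Derivation.leibniz, Derivation.leibniz_pow, smul_eq_mul, hu, hv]
    ring
  rw [key]
  refine Ideal.add_mem _ (Ideal.add_mem _ (Ideal.add_mem _ ?_ ?_) ?_) hDh
  · exact Ideal.mul_mem_left _ _ hu2
  · exact Ideal.mul_mem_left _ _ huv
  · exact Ideal.mul_mem_left _ _ hv2

/-- **`(u, v) ≤ (D₁ G, D₂ G) + (u, v)²`** for the node equation `G = a u² + b uv + c v² + h`, `h ∈ (u,v)³`, `b² − 4ac` a unit:
`(4ac − b²)·u = 2c·(2a u + b v) − b·(b u + 2c v)` and symmetrically for `v` (every characteristic). [folklore; computation] -/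
theorem node_span_le_sup_sq (D₁ D₂ : Derivation S R R) (u v a b c h : R) (h1u : D₁ u = 1) (h1v : D₁ v = 0) (h2u : D₂ u = 0)
    (h2v : D₂ v = 1) (hh : h ∈ Ideal.span {u, v} ^ 3) (hdisc : IsUnit (b ^ 2 - 4 * a * c)) :
    Ideal.span {u, v} ≤ Ideal.span {D₁ (a * u ^ 2 + b * u * v + c * v ^ 2 + h), D₂ (a * u ^ 2 + b * u * v + c * v ^ 2 + h)} ⊔
      Ideal.span {u, v} ^ 2 := by
  set G := a * u ^ 2 + b * u * v + c * v ^ 2 + h with hGdef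
  set I := Ideal.span {D₁ G, D₂ G} ⊔ Ideal.span {u, v} ^ 2 with hI
  have hx₁ : 2 * a * u + b * v ∈ I := by
    have hD : D₁ G ∈ I := Ideal.mem_sup_left (Ideal.subset_span (by simp))
    have h' : _ ∈ I := Ideal.mem_sup_right (node_deriv_fst_sub_mem_sq D₁ u v a b c h h1u h1v hh)
    have := Ideal.sub_mem I hD h'
    simpa [hGdef] using this
  have hx₂ : b * u + 2 * c * v ∈ I := by
    have hD : D₂ G ∈ I := Ideal.mem_sup_left (Ideal.subset_span (by simp))
    have h' : _ ∈ I := Ideal.mem_sup_right (node_deriv_snd_sub_mem_sq D₂ u v a b c h h2u h2v hh)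
    have := Ideal.sub_mem I hD h'
    simpa [hGdef] using this
  obtain ⟨d, hd⟩ := hdisc
  have hdu : (b ^ 2 - 4 * a * c) * u ∈ I := by
    have : (b ^ 2 - 4 * a * c) * u = b * (b * u + 2 * c * v) - 2 * c * (2 * a * u + b * v) := by ring
    rw [this]; exact Ideal.sub_mem _ (Ideal.mul_mem_left _ _ hx₂) (Ideal.mul_mem_left _ _ hx₁)
  have hdv : (b ^ 2 - 4 * a * c) * v ∈ I := by
    have : (b ^ 2 - 4 * a * c) * v = b * (2 * a * u + b * v) - 2 * a * (b * u + 2 * c * v) := by ring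
    rw [this]; exact Ideal.sub_mem _ (Ideal.mul_mem_left _ _ hx₁) (Ideal.mul_mem_left _ _ hx₂)
  have hu : u ∈ I := by
    have := Ideal.mul_mem_left I (↑d⁻¹ : R) hdu
    rwa [← hd, ← mul_assoc, Units.inv_mul, one_mul] at this
  have hv : v ∈ I := by
    have := Ideal.mul_mem_left I (↑d⁻¹ : R) hdv
    rwa [← hd, ← mul_assoc, Units.inv_mul, one_mul] at this
  rw [Ideal.span_le]
  rintro x hx
  rcases hx with rfl | hx
  · exact hu
  · rw [Set.mem_singleton_iff] at hx; subst hx; exact hv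

/-- NAKAYAMA, in the form used here: in a commutative ring, if a finitely generated ideal `N` lies in a prime `𝔪` and `N ≤ J + N²`, then
`N ≤ 𝔭` for every prime `𝔭 ≤ 𝔪` containing `J` (localise at `𝔪`: there `N ≤ J` by Nakayama). [folklore] -/
theorem le_of_le_sup_sq_of_prime {N J 𝔪 𝔭 : Ideal R} [𝔪.IsPrime] [𝔭.IsPrime] (hN : N.FG) (hN𝔪 : N ≤ 𝔪) (hNJ : N ≤ J ⊔ N ^ 2)
    (h𝔭𝔪 : 𝔭 ≤ 𝔪) (hJ : J ≤ 𝔭) : N ≤ 𝔭 := by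
  let L := Localization.AtPrime 𝔪
  let f := algebraMap R L
  have hN' : N.map f ≤ J.map f ⊔ (maximalIdeal L) • N.map f := by
    have h1 : N.map f ≤ J.map f ⊔ N.map f ^ 2 := by
      calc N.map f ≤ (J ⊔ N ^ 2).map f := Ideal.map_mono hNJ
        _ = J.map f ⊔ N.map f ^ 2 := by rw [Ideal.map_sup, Ideal.map_pow]
    have h2 : N.map f ^ 2 ≤ (maximalIdeal L) • N.map f := by
      rw [pow_two, smul_eq_mul]
      refine Ideal.mul_mono_left ?_
      rw [← Localization.AtPrime.map_eq_maximalIdeal]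
      exact Ideal.map_mono hN𝔪
    exact h1.trans (sup_le_sup_left h2 _)
  have hjac : maximalIdeal L ≤ (⊥ : Ideal L).jacobson := by
    rw [IsLocalRing.jacobson_eq_maximalIdeal ⊥ bot_ne_top]
  have hNle : N.map f ≤ J.map f :=
    Submodule.le_of_le_smul_of_le_jacobson_bot (hN.map _) hjac hN'
  have h2 : N.map f ≤ 𝔭.map f := hNle.trans (Ideal.map_mono hJ)
  have hdisj : Disjoint (𝔪.primeCompl : Set R) 𝔭 := by
    rw [Set.disjoint_left]
    intro x hx hx𝔭
    exact hx (h𝔭𝔪 hx𝔭)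
  calc N ≤ (N.map f).comap f := Ideal.le_comap_map
    _ ≤ (𝔭.map f).comap f := Ideal.comap_mono h2
    _ = 𝔭 := IsLocalization.under_map_of_isPrime_disjoint 𝔪.primeCompl L ‹_› hdisj

/-- **THE SINGULAR LOCUS NEAR A NODE IS THE SECTION.**  Node equation `G = a u² + b uv + c v² + h`, `h ∈ (u,v)³`, `b² − 4ac` a unit, derivations
`D₁, D₂` dual to `u, v`, and a prime `𝔪 ∋ u, v` (the node point): every prime `𝔭 ⊆ 𝔪` containing `D₁ G` and `D₂ G` contains `u` and `v`.
[folklore; every characteristic] -/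
theorem node_mem_of_derivs_mem (D₁ D₂ : Derivation S R R) (u v a b c h : R) (h1u : D₁ u = 1) (h1v : D₁ v = 0) (h2u : D₂ u = 0)
    (h2v : D₂ v = 1) (hh : h ∈ Ideal.span {u, v} ^ 3) (hdisc : IsUnit (b ^ 2 - 4 * a * c))
    {𝔪 𝔭 : Ideal R} [𝔪.IsPrime] [𝔭.IsPrime] (hu : u ∈ 𝔪) (hv : v ∈ 𝔪) (h𝔭𝔪 : 𝔭 ≤ 𝔪)
    (hD₁ : D₁ (a * u ^ 2 + b * u * v + c * v ^ 2 + h) ∈ 𝔭) (hD₂ : D₂ (a * u ^ 2 + b * u * v + c * v ^ 2 + h) ∈ 𝔭) :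
    u ∈ 𝔭 ∧ v ∈ 𝔭 := by
  have hN : (Ideal.span {u, v} : Ideal R).FG :=
    Submodule.fg_def.mpr ⟨{u, v}, (Set.finite_singleton v).insert u, rfl⟩
  have hN𝔪 : Ideal.span {u, v} ≤ 𝔪 := by
    rw [Ideal.span_le]; rintro x (rfl | hx)
    · exact hu
    · rw [Set.mem_singleton_iff] at hx; subst hx; exact hv
  have hJ : Ideal.span {D₁ (a * u ^ 2 + b * u * v + c * v ^ 2 + h), D₂ (a * u ^ 2 + b * u * v + c * v ^ 2 + h)} ≤ 𝔭 := by
    rw [Ideal.span_le]; rintro x (rfl | hx)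
    · exact hD₁
    · rw [Set.mem_singleton_iff] at hx; subst hx; exact hD₂
  have h := le_of_le_sup_sq_of_prime hN hN𝔪 (node_span_le_sup_sq D₁ D₂ u v a b c h h1u h1v h2u h2v hh hdisc) h𝔭𝔪 hJ
  exact ⟨h (Ideal.subset_span (by simp)), h (Ideal.subset_span (by simp))⟩

/-- … contrapositive: a prime `𝔭 ⊆ 𝔪` NOT containing the section ideal misses `D₁ G` or `D₂ G`. [folklore] -/
theorem node_deriv_not_mem (D₁ D₂ : Derivation S R R) (u v a b c h : R) (h1u : D₁ u = 1) (h1v : D₁ v = 0) (h2u : D₂ u = 0)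
    (h2v : D₂ v = 1) (hh : h ∈ Ideal.span {u, v} ^ 3) (hdisc : IsUnit (b ^ 2 - 4 * a * c))
    {𝔪 𝔭 : Ideal R} [𝔪.IsPrime] [𝔭.IsPrime] (hu : u ∈ 𝔪) (hv : v ∈ 𝔪) (h𝔭𝔪 : 𝔭 ≤ 𝔪) (hsec : ¬ (u ∈ 𝔭 ∧ v ∈ 𝔭)) :
    D₁ (a * u ^ 2 + b * u * v + c * v ^ 2 + h) ∉ 𝔭 ∨ D₂ (a * u ^ 2 + b * u * v + c * v ^ 2 + h) ∉ 𝔭 := by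
  by_contra hcon
  simp only [not_or, not_not] at hcon
  exact hsec (node_mem_of_derivs_mem D₁ D₂ u v a b c h h1u h1v h2u h2v hh hdisc hu hv h𝔭𝔪 hcon.1 hcon.2)

/-- **`V(G)` IS REGULAR OFF THE SECTION NEAR A NODE**: with the node data at `𝔪 ∋ u, v` and `G ∈ 𝔭 ⊆ 𝔪` a prime not containing the section
ideal `(u, v)`, if `R_𝔭` is regular then so is `R_𝔭 / (G)`, of dimension `dim R_𝔭 − 1`. [folklore; every characteristic] -/
theorem node_isRegularLocalRing_quotient {Rₚ : Type*} [CommRing Rₚ] [Algebra R Rₚ] (D₁ D₂ : Derivation S R R) (u v a b c h : R)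
    (h1u : D₁ u = 1) (h1v : D₁ v = 0) (h2u : D₂ u = 0) (h2v : D₂ v = 1) (hh : h ∈ Ideal.span {u, v} ^ 3)
    (hdisc : IsUnit (b ^ 2 - 4 * a * c)) {𝔪 𝔭 : Ideal R} [𝔪.IsPrime] [𝔭.IsPrime] [IsRegularLocalRing Rₚ] [IsLocalization.AtPrime Rₚ 𝔭]
    (hu : u ∈ 𝔪) (hv : v ∈ 𝔪) (h𝔭𝔪 : 𝔭 ≤ 𝔪) (hG : a * u ^ 2 + b * u * v + c * v ^ 2 + h ∈ 𝔭) (hsec : ¬ (u ∈ 𝔭 ∧ v ∈ 𝔭)) :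
    IsRegularLocalRing (Rₚ ⧸ Ideal.span {algebraMap R Rₚ (a * u ^ 2 + b * u * v + c * v ^ 2 + h)}) ∧
      ringKrullDim (Rₚ ⧸ Ideal.span {algebraMap R Rₚ (a * u ^ 2 + b * u * v + c * v ^ 2 + h)}) + 1 = ringKrullDim Rₚ := by
  rcases node_deriv_not_mem D₁ D₂ u v a b c h h1u h1v h2u h2v hh hdisc hu hv h𝔭𝔪 hsec with h₁ | h₂
  · exact isRegularLocalRing_quotient_of_derivation_not_mem 𝔭 D₁ hG h₁
  · exact isRegularLocalRing_quotient_of_derivation_not_mem 𝔭 D₂ hG h₂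

end Node


end Summit.ResolutionOfSingularities.ResolutionOfSingularities.Cruxes.EquisingularLiftNat.Sections.Equinodal.NodeReg

end
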